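import Mathlib.Tactic.Linarith
import Mathlib.Tactic.NormNum
import Mathlib.Tactic.Ring
import Mathlib.Tactic.LinearCombination
import Mathlib.Algebra.BigOperators.Group.Finset.Basic
import Mathlib.Data.Nat.Choose.Basic
import HarnessLib

/-!
# The (0,1) cell of the ι-window, XXVIII: the product ground `B₁ × B₂`, XV — the NODE AXIS COMPLETED: the local engine at the
# eight toric points `P_q` (direct-image lengths weight by weight; the conductor restriction of the hull; the cancellation
# `μ = 0`), the budget identity and the window equation, the examples `W` / `W′`, the empty windows, the transport count
# (report [XXVIII]): arithmetic shadows

Family `hodge`, b2b cell `hweil` (helper of item stmt-HodgeConjecture-2524). Report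
`run/shared/lean/b2b/hodge-weil/b2b-hweil-pv1-g40/H2-ZERO-ONE-28.md` ([XXVIII]); scripts `code/pv1-g40/na_local.py`, `na_rows.py`.
Continues `WeilTypeLadderH2ProductGroundFourteen{,B,C}.lean` (`pg14_*`, `pg14a_*`, `pg14b_*`).
HONEST FRAMING: census results inside the ladder's H2 test ((0,1) cell) on the SPECIAL fourfold `X₀ = B₁ × B₂`; nothing here is a rung; no
case of the Hodge conjecture is proved; no statement of [Markman 2025] / [Perry 2026] / [EdGFS 2025] is used. Every theorem is a def-free
arithmetic identity that the report cites at the step named in its docstring; none claims geometry.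
-/

-- mandated namespace `Summit.HodgeConjecture.HodgeConjecture.…` (Problem = Summit) trips `linter.dupNamespace`; the lakefile disables it
-- tree-wide (weak option), restated here so stand-alone elaboration is warning-free too.
set_option linter.dupNamespace false

open Finset

namespace Summit.HodgeConjecture.HodgeConjecture.WeilTypeLadder

section ProductGroundFifteen

/-- **LEMMA R1-N ([XXVIII] 3.2): the direct-image engine at a toric point `P_q`, key instances.** For a `𝕋²`-equivariant sheaf
`G = 𝓘_Z 𝒪(W̃)` near the contracted curve `ℓ_q` (normal bundle `𝒪(−1) ⊕ 𝒪(−2)`), with `c` conductor germs through `P_q` and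
`d = deg 𝒪(W̃)|_{ℓ_q}`, the weight-`(j,k)` piece is `𝒪_{ℙ¹}(d + j + 2k − c·[j = 0])`, so `ℓ(R¹π′_*G) = Σ_{j,k ≥ 0} (c[j=0] − d − j − 2k − 1)⁺`.
Instances (in `ℕ`, truncated subtraction; `j, k < 12` suffices): one conductor fibre with `d = −1` gives `1` (the weight-`(0,0)` piece `𝒪(−2)`)
— the six points `P_q`, `q ∉ {±q₀}`, of the hull `W_w`; one fibre with `d = 1` gives `0`; no germ with `d = −2` gives `λ(−2) = 1` (LEMMA N-TOR);
two germs with `d = −2` give `4`; two germs with `d = 0` give `1`. [`decide`] -/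
theorem pg15_R1_engine :
    (((range 12).sum fun j => (range 12).sum fun k => ((if j = 0 then 1 else 0) + 1 - j - 2 * k - 1)) = 1) ∧
    (((range 12).sum fun j => (range 12).sum fun k => ((if j = 0 then 1 else 0) - j - 2 * k - 2)) = 0) ∧
    (((range 12).sum fun j => (range 12).sum fun k => (2 - j - 2 * k - 1)) = 1) ∧
    (((range 12).sum fun j => (range 12).sum fun k => ((if j = 0 then 2 else 0) + 2 - j - 2 * k - 1)) = 4) ∧
    (((range 12).sum fun j => (range 12).sum fun k => ((if j = 0 then 2 else 0) - j - 2 * k - 1)) = 1) := by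
  refine ⟨by decide, by decide, by decide, by decide, by decide⟩

/-- **LEMMA R1-N ([XXVIII] 3.2 (b)–(c)): the closed form.** For `d ≥ −2` and no horizontal germ only the weights `(0,k)` contribute and
`R1(d; c, 0) = S(c − d − 1)` with `S(n) = Σ_{k ≥ 0} (n − 2k)⁺`; the values `S(0..6) = 0, 1, 2, 4, 6, 9, 12` (so the table of 3.2 (c) reads, row
`d = −1`: `S(c) = 0, 1, 2, 4, 6` for `c = 0..4`, row `d = −2`: `S(c+1)`, row `d = 0`: `S(c−1)`, …). [`decide`] -/
theorem pg15_R1_table :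
    (((range 8).sum fun k => (0 - 2 * k)) = 0) ∧ (((range 8).sum fun k => (1 - 2 * k)) = 1) ∧
    (((range 8).sum fun k => (2 - 2 * k)) = 2) ∧ (((range 8).sum fun k => (3 - 2 * k)) = 4) ∧
    (((range 8).sum fun k => (4 - 2 * k)) = 6) ∧ (((range 8).sum fun k => (5 - 2 * k)) = 9) ∧
    (((range 8).sum fun k => (6 - 2 * k)) = 12) := by
  refine ⟨by decide, by decide, by decide, by decide, by decide, by decide, by decide⟩

/-- **LEMMA RES-N ([XXVIII] 3.3): the conductor restriction of the hull at `P_q`.** (d) For `e = d − c = 2n ≥ 0` the torsion-free part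
`𝓜 = 𝔪_C^n · g₀` of the restriction to the `A₁`-point has colength `Σ_{i<n} (2i+1) = n²` in its (locally free) hull and its sheet-invariant
part `𝔪_q^n g₀` has colength `Σ_{i<n}(i+1) = n(n+1)/2` in `ℂ[α,β]g₀`; (e) the difference `μ(n) = n² − n(n+1)/2 = n(n−1)/2` VANISHES for `n ≤ 1`,
i.e. for `e ≤ 2` — every hull class of LEMMA CS2-N (`|d| ≤ 2`); (a) the torsion of the hull's restriction has length
`τ(d) = #{(j,k) : j ≥ 1, j + 2k = −d} = ⌈−d/2⌉`: `1, 1, 2, 2, 3` for `d = −1, …, −5`. [`decide`] -/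
theorem pg15_conductor_restriction :
    (∀ n ∈ range 6, ((range n).sum fun i => (2 * i + 1)) = n ^ 2) ∧
    (∀ n ∈ range 6, 2 * ((range n).sum fun i => (i + 1)) = n * (n + 1)) ∧
    (∀ n ∈ range 6, 2 * (n ^ 2 - (range n).sum fun i => (i + 1)) = n * (n - 1)) ∧
    (0 * (0 - 1) = (0:ℕ) ∧ 1 * (1 - 1) = (0:ℕ)) ∧
    ((((range 7) ×ˢ (range 7)).filter fun p : ℕ × ℕ => 1 ≤ p.1 ∧ p.1 + 2 * p.2 = 1).card = 1 ∧
     (((range 7) ×ˢ (range 7)).filter fun p : ℕ × ℕ => 1 ≤ p.1 ∧ p.1 + 2 * p.2 = 2).card = 1 ∧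
     (((range 7) ×ˢ (range 7)).filter fun p : ℕ × ℕ => 1 ≤ p.1 ∧ p.1 + 2 * p.2 = 3).card = 2 ∧
     (((range 7) ×ˢ (range 7)).filter fun p : ℕ × ℕ => 1 ≤ p.1 ∧ p.1 + 2 * p.2 = 4).card = 2 ∧
     (((range 7) ×ˢ (range 7)).filter fun p : ℕ × ℕ => 1 ≤ p.1 ∧ p.1 + 2 * p.2 = 5).card = 3) := by
  refine ⟨by decide, by decide, by decide, by decide, by decide⟩

/-- **PROPOSITION PQ-N ([XXVIII] 4.1 (b)): the window equation.** From the `(pt₁,θ₂)` entry `E₁ = v_cos + γ′` with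
`v_cos = 2m + v′`, `γ′ = n₀ − 2 + τ′` and `m = a₂ − v_w − n₀` one gets `v′ + τ′ = c_E + n₀`, `c_E := E₁ + 2 − 2a₂ + 2v_w`; on the four hull classes
`(E₁, a₂, v_w) = (2,2,1), (2,2,0), (3,1,−1), (1,1,0)` (`W_w, W₀, W_w′, W₀′`): `c_E = 2, 0, 1, 1`; with `m ≥ 0`, `v′, τ′ ≥ 0` the windows are
`−c_E ≤ n₀ ≤ a₂ − v_w`, i.e. `[−2,1], [0,2], [−1,2], [−1,1]`. [`omega` / `norm_num`] -/
theorem pg15_window_equation :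
    (∀ E a₂ v m vp n₀ τ : ℤ, E = (2 * m + vp) + (n₀ - 2 + τ) → m = a₂ - v - n₀ → vp + τ = (E + 2 - 2 * a₂ + 2 * v) + n₀) ∧
    ((2:ℤ) + 2 - 2 * 2 + 2 * 1 = 2 ∧ (2:ℤ) + 2 - 2 * 2 + 2 * 0 = 0 ∧ (3:ℤ) + 2 - 2 * 1 + 2 * (-1) = 1 ∧ (1:ℤ) + 2 - 2 * 1 + 2 * 0 = 1) ∧
    (∀ cE a₂ v n₀ m vp τ : ℤ, vp + τ = cE + n₀ → m = a₂ - v - n₀ → 0 ≤ m → 0 ≤ vp → 0 ≤ τ → -cE ≤ n₀ ∧ n₀ ≤ a₂ - v) ∧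
    ((-(2:ℤ) = -2 ∧ (2:ℤ) - 1 = 1) ∧ (-(0:ℤ) = 0 ∧ (2:ℤ) - 0 = 2) ∧ (-(1:ℤ) = -1 ∧ (1:ℤ) - (-1) = 2) ∧ (-(1:ℤ) = -1 ∧ (1:ℤ) - 0 = 1)) := by
  refine ⟨?_, by norm_num, ?_, by norm_num⟩
  · intro E a₂ v m vp n₀ τ h1 h2
    omega
  · intro cE a₂ v n₀ m vp τ h1 h2 h3 h4 h5
    omega

/-- **PROPOSITION PQ-N ([XXVIII] 4.1 (c)): the budget identity on `Σ̃`.** `ch₄(F) = −2` with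
`ch₄(ν_*F̃) = [E₁ − χ(Q_G)] + ℓ(R¹π′_*G) − c_P` and `ch₄(F) = ch₄(ν_*F̃) − χ(𝒢)` is equivalent to
`χ(Q_G) − ℓ(R¹) + c_P + χ(𝒢) = E₁ + 2`; and (GLUE-N (c) with total colengths)
`χ(𝒢) = χ_T + [χ(δ̄^*𝒩) − ℓ_𝓜] − [χ(𝒩) − ℓ(W₀)]`, `χ(δ̄^*𝒩) = n₀² + (n₀−2)²`, `χ(𝒩) = n₀²`, i.e. `χ(𝒢) = χ_T + (n₀ − 2)² − ℓ_𝓜 + ℓ(W₀)`. [`omega` / `ring`] -/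
theorem pg15_budget_identity :
    (∀ E χQ R cP χG : ℤ, (E - χQ) + R - cP - χG = -2 ↔ χQ - R + cP + χG = E + 2) ∧
    (∀ χT n lM lW : ℤ, χT + ((n ^ 2 + (n - 2) ^ 2) - lM) - (n ^ 2 - lW) = χT + (n - 2) ^ 2 - lM + lW) := by
  refine ⟨fun E χQ R cP χG => by omega, fun χT n lM lW => by ring⟩

/-- **LEMMA Q22-N ([XXVIII] 4.3): the degree table.** With `a₁ + a₂ = 3`, `v_w + x₃ + x₄ = 3 − 2a₁`, `Sh1 = 6 − 4a₂` (N-PAR / CS2):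
`(α)` `4a₂ + Sh1 = 6`; `(α′)` `4a₁ + 2(v_w + x₃ + x₄) = 6`; `(β′)` `2a₁ + (v_w + x₃ + x₄) = 3`; `(β)` doubled `4a₂ + Sh1 = 6`; and the Euler
characteristics `χ(𝒪) = −2j² − 4j + Σb²` of the conductor pull-backs: `−6` (`Θ_κ`, no base point), `−4` (`Θ_κ` through a base pair), `−16` (`C₂`),
`−30` (`C₃`); the theta pull-back for `W_w` without base points: `χ = 4·2 + 0 − 1·4 − 6 + 0 = −2`. [`omega` / `norm_num`] -/
theorem pg15_curve_degrees :
    (∀ a₁ a₂ v x₃ x₄ S : ℤ, a₁ + a₂ = 3 → v + x₃ + x₄ = 3 - 2 * a₁ → S = 6 - 4 * a₂ →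
      4 * a₂ + S = 6 ∧ 4 * a₁ + 2 * (v + x₃ + x₄) = 6 ∧ 2 * a₁ + (v + x₃ + x₄) = 3) ∧
    (-(2:ℤ) * 1 ^ 2 - 4 * 1 + 0 = -6 ∧ -(2:ℤ) * 1 ^ 2 - 4 * 1 + (1 + 1) = -4 ∧ -(2:ℤ) * 2 ^ 2 - 4 * 2 + 0 = -16 ∧
     -(2:ℤ) * 3 ^ 2 - 4 * 3 + 0 = -30) ∧
    ((4:ℤ) * 2 + 0 - 1 * 4 - 6 + 0 = -2) := by
  refine ⟨?_, by norm_num, by norm_num⟩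
  intro a₁ a₂ v x₃ x₄ S h1 h2 h3
  omega

/-- **EXAMPLE W ([XXVIII] 5.4): the hull class `W_w` is POPULATED — bookkeeping.** Hull `W_w` (`a₁ = 1, v_w = 1, a₂ = 2, h(q₀) = −1`, `E₁ = 2`),
cosupport `η_x ⊔ {w₁} × D̃ ⊔ (Θ₁ ± x′)~ × {±q̃}` (`q ≠ ±q₀`): `m = 1`, `n₀ = a₂ − v_w − m = 0`; `χ(Q_G) = 2 + 2 + (1 + 1) = 6` (degrees `6, 6, 2, 2`
on curves of genus `5, 5, 2, 2`); `ℓ(R¹) = 6·1 + 2·0 = 6`; `χ(𝒢) = 0 + (0 − 2)² − 0 + 0 = 4`; budget `6 − 6 + 0 + 4 = 4 = E₁ + 2`; the `(pt₁,θ₂)`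
entry `E₁ − v_cos − γ′ = 2 − (2 + 2) − (0 − 2 + 0) = 0`; `(θ₁,pt₂)`: `2 − 2 = 0`; window `v′ + τ′ = 2 + 0 = c_E + n₀ = 2 + 0`; parity at the `P_q`:
`d − c = 1 − 1` and `−1 − 1` even. [`norm_num` / `decide`] -/
theorem pg15_example_W :
    ((2:ℤ) - 1 - 1 = 0) ∧ ((6:ℤ) + 1 - 5 = 2 ∧ (2:ℤ) + 1 - 2 = 1 ∧ (2:ℤ) + 2 + (1 + 1) = 6) ∧ ((6:ℤ) * 1 + 2 * 0 = 6) ∧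
    ((0:ℤ) + (0 - 2) ^ 2 - 0 + 0 = 4) ∧ ((6:ℤ) - 6 + 0 + 4 = 2 + 2) ∧ ((2:ℤ) - (2 + 2) - (0 - 2 + 0) = 0) ∧ ((2:ℤ) - 2 = 0) ∧
    ((2:ℤ) + 0 = 2 + 0) ∧ (((1:ℤ) - 1) % 2 = 0 ∧ ((-1:ℤ) - 1) % 2 = 0) := by
  norm_num

/-- **EXAMPLE W′ ([XXVIII] 5.5): the hull class `W_w′` is POPULATED — bookkeeping.** Hull `W_w′` (`a₁ = 2, v_w = −1, a₂ = 1, h(q₀) = +1`,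
`E₁ = 3`), cosupport `η_x ⊔ {w₁} × D̃ ⊔ Ẽ_{t₂(w₂)} × {w₂}`: `m = 1`, `n₀ = 1 − (−1) − 1 = 1`; `χ(Q_G) = 2 + 2 + 3 = 7` (genus-4 curve: `6 + 1 − 4 = 3`);
`ℓ(R¹) = 2·1 + 6·0 = 2` (one germ at `P_{±q₀}` where `d = −1`); the `(α′)`-curve's full crossing pair at the fixed point: `ℓ(W₀) − ℓ_𝓜 = 1 − 2`;
`χ(𝒢) = 0 + (1 − 2)² + 1 − 2 = 0`; budget `7 − 2 + 0 + 0 = 5 = E₁ + 2`; `(pt₁,θ₂)`: `3 − (2 + 2) − (1 − 2 + 0) = 0`; window `2 + 0 = 1 + 1`;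
balance at the fixed point `t = (−3)·0 = 0` (FIX-N (b)). [`norm_num`] -/
theorem pg15_example_Wprime :
    ((1:ℤ) - (-1) - 1 = 1) ∧ ((6:ℤ) + 1 - 4 = 3 ∧ (2:ℤ) + 2 + 3 = 7) ∧ ((2:ℤ) * 1 + 6 * 0 = 2) ∧
    ((0:ℤ) + (1 - 2) ^ 2 + 1 - 2 = 0) ∧ ((7:ℤ) - 2 + 0 + 0 = 3 + 2) ∧ ((3:ℤ) - (2 + 2) - (1 - 2 + 0) = 0) ∧
    ((2:ℤ) + 0 = 1 + 1) ∧ ((-3:ℤ) * 0 = 0) := by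
  norm_num

/-- **[XXVIII] 5.2: the EMPTY windows — the arithmetic of the two obstructions.** (i) `m = 0` with `v_w` odd: the number `f` of conductor fibre
components satisfies `f ≡ v_w (mod 2)` (parity at the `P_q`) and `0 ≤ f ≤ m`, impossible for `m = 0`, `v_w` odd (the windows `(W_w, n₀ = 1)`,
`(W_w′, n₀ = 2)`; = GLUE-N (d)); (ii) `(W₀, n₀ = 1)` / `(W₀′, n₀ = 0)`: `m = 1` and `v′ + τ′ = c_E + n₀ = 1` with `v′ ∈ {0, 2}` force `τ′ = 1`,
a rank-one torsion datum on a theta pull-back — unavailable for `v_w = 0` ([XXVIII] 3.6: the torsion is not a pull-back there); the arithmetic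
half: `τ′ = 1` is forced. [`omega`] -/
theorem pg15_empty_windows :
    (∀ f m : ℕ, f ≤ m → m = 0 → f % 2 = 1 → False) ∧
    (∀ vp τ : ℕ, vp + τ = 1 → (vp = 0 ∨ vp = 2) → τ = 1) ∧
    ((0:ℤ) + 1 = 1 ∧ (1:ℤ) + 0 = 1 ∧ (2:ℤ) - 0 - 1 = 1 ∧ (1:ℤ) - 0 - 0 = 1) := by
  refine ⟨?_, ?_, by norm_num⟩
  · intro f m h1 h2 h3
    omega
  · intro vp τ h1 h2
    omega

/-- **PROPOSITION GEN-S / LEMMA USE-N / THEOREM N ([XXVIII] 2.3, 6.3, 6.4): the transport count; and PQ-N (f)'s supertrace.** The node-axis type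
stratum `𝒩(w) × 𝒲 × PGL₂` has dimension `2 + 4 + 3 = 9`; a row uses at most `3` conditions on the support beyond its type (at most `2` on every one
of the 351 enumerated row types), so transport gives `e₁^ι ≥ 9 − 3 = 6 ≥ 2` (`≥ 7` on the listed rows); and a length-one quotient `k(x)` at a fixed
point of `ι` on the fourfold has local index `Σ_i (−1)^i tr(ι | ∧^i T^*_x) = Σ_i (−1)^i(−1)^i C(4,i) = 16 ≠ 0` (fillers at fixed points have even
length). [`norm_num` / `decide`] -/
theorem pg15_transport_dimensions :
    ((2:ℤ) + 4 + 3 = 9 ∧ (9:ℤ) - 3 = 6 ∧ (2:ℤ) ≤ 6 ∧ (9:ℤ) - 2 = 7) ∧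
    (((range 5).sum fun i => ((-1:ℤ) ^ i * (-1) ^ i) * (Nat.choose 4 i : ℤ)) = 16) := by
  refine ⟨by norm_num, by decide⟩

end ProductGroundFifteen

end Summit.HodgeConjecture.HodgeConjecture.WeilTypeLadder
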